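import Mathlib
import Literature.MathematicalPhysics.QuantumFieldTheory.Balaban1983to89.B12Sec2to5
import Literature.MathematicalPhysics.QuantumFieldTheory.Balaban1983to89.B12TreeDecay

/-!
# `Balaban1983to89.B12Decay510` — T. Bałaban, *Renormalization group approach to lattice gauge field theories. I.
Generation of effective actions in a small field approximation and a coupling constant renormalization in four
dimensions*, Commun. Math. Phys. **109**, 249–301 (1987) [Balaban1987RG1]: **the derivation of (5.10)** (journal p. 293;
PDF page = journal page − 248; PDF held: `paper:balaban1987-cmp109-rg-i-small-field`).

CITATION HEADER (lean-in-tree rule 2026-08-18).  Satellite of `…Balaban1983to89.B12Sec2to5` (§§2–5 skeleton, where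
(5.10) is the HYPOTHESIS `B12Sec2to5.Decay510` of the kernel-checked β′-edge `secondMoment_abs_le_of_decay510` /
`betaUpper_of_decay510`) and of `…Balaban1983to89.B12TreeDecay` (the domain sum (0.26)/(1.26) proved modulo the
published volume leaf).  Unit `b2b-balaban-b03-g3` (paper sub-cell B03 gen 3, phase-2 row P12b owner lineage), cell
census row `G-B12s-15` (the one ASSERTED input of §5).  Quotations re-read on the 300-dpi renders
`HOME/b2b-balaban-ref1/pages/1987-cmp109-rg-I-small-field/…-p009/p015/p033/p034/p042/p043/p044/p045-x2.png`.

WHAT THE PAPER PRINTS (and nothing else is attributed to it):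
* p. 293 [PDF 45], verbatim: *"The representation (4.37) yields the following inequality
  ∣Π_{μν}(x − y)∣ ≤ O(1)E₀ exp(−δ₁∣x − y∣), (5.10) with a positive constant δ₁ determined by δ₀, κ, and M (e.g.,
  δ₁ = 1/2min{δ₀, κM⁻¹})."* — NO derivation is printed ("yields"); the example value δ₁ = ½ min{δ₀, κM⁻¹} is the one
  typed below (`delta1`).  (The sentence *"It follows from (1.18) and (5.9) by the usual arguments"* quoted in earlier
  cell records is NOT in print — cell GAPS G-pv13-4 (1).)
* p. 291 [43], (4.37), verbatim: *"Π_{μ,ν}(x, y) = Σ_{X∈𝐃⁰_j} 𝐄^{(2)}_{μ,ν}(X, x, y), and the irrelevant terms resummed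
  over X ∈ 𝐃_j, X ⊂ □̃². The function Π is called the vacuum polarization tensor."*; p. 293 (5.8): *"The function Π is
  also translation invariant and symmetric, hence Π_{μν}(x, y) = Π_{μν}(x − y)"*; p. 292 (5.1): *"it can be defined
  also as Π(b, b′) = lim_{T₁^{(j)}↗Z⁴} (δ²/δB(b)δB(b′)) 𝐄^{(j)}(U_j(exp iB))∣_{B=0}."*
* p. 290 [42], (4.35), verbatim: *"For n = 2, and by the identity (4.14), the formula (4.3) yields
  𝐄^{(2)}(X) = ⟨(δ²/δ𝐇²)𝐄(X, 1), H_j(□₀), H_j(□₀)⟩."* (a bilinear form of the second 𝐇-derivative of the term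
  𝐄(X, ·) evaluated on two copies of the linearized minimizer).
* p. 282 [34], verbatim: *"The norm in (4.4) of the expression ⟨(δ^{n(p)}/δB^{n(p)})𝐇_j(□₀, 0), ⊗_{i∈N(p)}B_i⟩ can be
  estimated by B₃Π_{i∈N(p)}∣B_i∣, and if one of the functions B_i is localized outside the domain X, then we have the
  additional exponential factor exp(−δ₀dist^{(ξ)}(X, supp B_i))."* and (4.5) (n-th B-derivative of 𝐄^{(j)}(X, U_j(□₀,1))
  bounded by *"(2n²B₃(1/α₂))ⁿ E₀ exp(−κd_j(X)) exp(−δ₀dist^{(ξ)}(X, supp(1 − ζ̃_□)))"* times the sup norms) — the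
  Cauchy estimate from the inductive bound (1.18) p. 263 [15] *"∣𝐄^{(j)}(X, g_{j−1}, 𝐔, 𝐉)∣ ≤ E₀ exp(−κd_j(X))"* on the
  analyticity domain (4.4), for a function which p. 263 says *"depends on the configurations restricted to X, i.e. on
  (𝐔, 𝐉)∣_X"*.
* p. 281 [33], (4.3) (its second form), verbatim: *"= Σ (∂^r/∂τ₁…∂τ_r) 𝐄^{(j)}(X, exp iξ Σ_{p=1}^r τ_p ⟨(δ^{n(p)}/δB^{n(p)})
  𝐇_j(□₀, 0), ⊗_{i∈N(p)} B_i⟩)∣_{τ=0} = Σ Π_{p=1}^r (1/2πi) ∮ (dτ_p/τ_p²) 𝐄^{(j)}(X, exp iξ Σ_{p=1}^r τ_p ⟨…⟩)"* and,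
  same page: *"In the last formula above we have the function 𝐄^{(j)}(X, exp iξ𝐀), i.e. the function with 𝐔 = 1, 𝐉 = 0.
  Thus it is defined and analytic on the space of configurations 𝐀 satisfying
  max{∣𝐀∣_X, ∣P₁(□₀)𝐀∣_X, ∣∇^ξ𝐀∣_X, ∣Δ^ξ𝐀∣_X} < α₂. (4.4)"* (render p033-x2).
* p. 257 [9], verbatim: *"Consider a class of tree graphs contained in X and intersecting all the cubes in X. A length of
  a shortest graph in this class, divided by M, is the linear size of X, and is denoted by d_j(X)."*, and the domain sum
  pp. 257–258 (0.26) *"Σ_{X∈𝐃_j} … ≤ Σ_{□∈π_j} Σ_{X∈𝐃_j, X⊃□} …"* with Σ_{X⊃□} exp(−κd_j(X)) ≤ O(1) ([II] (1.26)),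
  in the tree `B12TreeDecay.CubeSystem.Ineq126Printed`, PROVED there modulo the published volume leaf
  (`B12TreeDecay.hTree_of_volumeLeaf`).

WHAT THIS MODULE PROVES (kernel-checked; every input a NAMED hypothesis, nothing asserted).  The "yields" of p. 293,
i.e. the standard polymer-sum argument, with the printed example constant δ₁ = ½ min{δ₀, κM⁻¹}:
(A) `sum_abs_le` / `abs_twoPoint_le`: on one (finite-volume, cf. (5.1)) system of localization domains with cubes
    (`B12.CubeCover`) and an abstract site set Λ with distance ρ = ∣x − y∣: IF every term obeys the two-sided kernel
    bound ∣𝐄^{(2)}(X, x, y)∣ ≤ C_E e^{−κd_j(X)} e^{−δ₀dist(x,X)} e^{−δ₀dist(y,X)} (`KernelBound`), the tree length controls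
    the diameter, ρ(x, y) ≤ dist(x, X) + dist(y, X) + M(d_j(X) + c₁) (`GeomLeaf`, p. 257), the cube sum
    Σ_□ e^{−(δ₀/2)dist(x,□)} ≤ K₁ (`CubeSumLeaf`) and the domain sum Σ_{X⊃□} e^{−(κ/2)d_j(X)} ≤ K₀ (`TreeLeaf` = the
    tree's `hTree` shape at κ/2) hold, THEN for every δ₁ with 0 ≤ δ₁ ≤ δ₀/2 and δ₁M ≤ κ/2 — in particular the printed
    δ₁ (`delta1_le_half`, `delta1_mul_le`) — ∣Σ_X 𝐄^{(2)}(X, x, y)∣ ≤ C_E e^{δ₁Mc₁} K₀ K₁ e^{−δ₁ρ(x,y)}.  The factor ½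
    in δ₁ is exactly the splitting e^{−κd_j} = e^{−(κ/2)d_j}·e^{−(κ/2)d_j}, e^{−δ₀dist} = e^{−(δ₀/2)dist}·e^{−(δ₀/2)dist}:
    one half produces the decay in ∣x − y∣, the other half pays the domain entropy.
(B) `kernelBound_of_repr435`: the two-sided kernel bound from the printed ingredients — the representation (4.35)
    𝐄^{(2)}(X, x, y) = Q_X(h_X(x), h_X(y)) with a bilinear-type Cauchy bound ∣Q_X(a, b)∣ ≤ A e^{−κd_j(X)}‖a‖‖b‖
    ((1.18) + (4.3)–(4.5), A = (8/α₂)²E₀ for n = 2) and the p. 282 decay ‖h_X(x)‖ ≤ B₃ e^{−δ₀dist(x,X)} of the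
    linearized minimizer applied to a field localized at x and restricted to X ([15] Sect. G) — giving C_E = A·B₃².
(C) `treeLeaf_of_volumeLeaf`: the domain-sum leaf DISCHARGED by the tree theorem `B12TreeDecay.hTree_of_volumeLeaf`
    for κ/2 ≥ κ₀(c₀, Δ) — this makes the implicit restriction "κ large compared with the domain entropy" (cell record
    H-ord.11) an explicit hypothesis `B12TreeDecay.kappa₀ c₀ Δ ≤ κ / 2`; `abs_twoPoint_le_of_volumeLeaf` assembles
    (A)+(B)+(C).
(D) `geomLeaf_of_diam`: the geometry leaf from "diameter ≤ M(d_j + c₁)" (any two points of X lie in cubes met by a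
    shortest tree, p. 257) and the triangle inequality.
(E) `decay510_of_tendsto`, `decay510_of_family`: the passage (5.1)/(5.11) to the infinite unit lattice ℤᵈ — a pointwise
    limit of kernels obeying the bound obeys it — landing LITERALLY in `B12Sec2to5.Decay510 P C δ₁`.
(F) `norm_mixedDeriv_le`: the Cauchy bilinear bound of (B) KERNEL-DERIVED — for a function E analytic on the ball
    ‖𝐀‖ < α₂ of a complex normed space ((4.4)) and bounded there by S ((1.18)), the r = 2 middle form of (4.3),
    ∂²/∂τ₁∂τ₂ E(τ₁a + τ₂b)∣_{τ=0} (`mixedDeriv`), satisfies ∣·∣ ≤ 4Sα₂⁻²‖a‖‖b‖ (two one-variable Cauchy estimates on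
    the circles ∣τ₁∣ = ρ/(2‖a‖), ∣τ₂∣ = ρ/(2‖b‖), ρ ↑ α₂; Mathlib `Complex.norm_deriv_le_of_forall_mem_sphere_norm_le`);
    `qBound_of_analytic` puts it in the shape `hQ` of (B) with A = 4E₀α₂⁻² (≤ the printed (2n²B₃α₂⁻¹)ⁿE₀/B₃ⁿ = 64E₀α₂⁻²
    at n = 2), and `decay510_of_analytic_leaves` is the end-to-end statement with this leaf discharged.
RESIDUAL LEAVES (named hypotheses, located in print, not proved here): analyticity of 𝐀 ↦ 𝐄^{(j)}(X, exp iξ𝐀) on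
(4.4) with the bound (1.18) there (the inductive hypotheses (1.5)/(1.18) of the paper — inputs, not disputed steps),
the decay of the restricted linearized minimizer (B) (by reference to [15] Sect. G), the diameter/tree-length
inequality and the cube lattice sum (elementary geometry of π_j, constants c₁, K₁ depending on d, M, δ₀ only), the
volume leaf of `B12TreeDecay` (published: Dimock, arXiv:1212.5562 Lemma E.1), and the existence of the limits
(5.1)/(5.11).
DIVERGENCES (cell DIVERGENCE.md D-b03.7–9): sites, distances dist(x, □), dist(x, X) and the norm ∣x − y∣ are abstract
carriers (print names no lattice norm — D-b03.4; the printed dist^{(ξ)} ≥ the unit-lattice distance since ξ ≤ 1, so the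
p. 282 factor implies the one used); the finite system models one torus T₁^{(j)} of (5.1), the ℤᵈ statement is reached
through the printed limit; the r = 1 term of (4.3) for n = 2 is absent from (4.35) as printed (its vanishing uses
δ𝐄(X, 1)/δ𝐇 = 0, cell note C-B12s) and is not modelled.  Value = kernel-checked derivation of a located asserted step
from named printed leaves, NOT summit progress.
-/

namespace Literature.MathematicalPhysics.QuantumFieldTheory.Balaban1983to89.B12Decay510

open Literature.MathematicalPhysics.QuantumFieldTheory.Balaban1983to89
open Filter Topology

/-! ## 1. The printed example constant δ₁ = ½ min{δ₀, κM⁻¹} of (5.10) -/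

/-- **δ₁ of (5.10)**, p. 293 [45], verbatim: *"with a positive constant δ₁ determined by δ₀, κ, and M (e.g.,
δ₁ = 1/2min{δ₀, κM⁻¹})"* — the example value, typed. [cite: Balaban1987RG1, (5.10) p.293] -/
noncomputable def delta1 (δ₀ κ M : ℝ) : ℝ := min δ₀ (κ / M) / 2

/-- δ₁ ≤ δ₀/2 (the half of the minimizer decay rate that is kept as decay in ∣x − y∣). [folklore] -/
theorem delta1_le_half (δ₀ κ M : ℝ) : delta1 δ₀ κ M ≤ δ₀ / 2 := by
  unfold delta1
  have h := min_le_left δ₀ (κ / M)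
  linarith

/-- δ₁M ≤ κ/2 for M > 0 (the half of the tree decay rate that is kept, converted by d_j = length/M). [folklore] -/
theorem delta1_mul_le (δ₀ κ : ℝ) {M : ℝ} (hM : 0 < M) : delta1 δ₀ κ M * M ≤ κ / 2 := by
  unfold delta1
  have h := min_le_right δ₀ (κ / M)
  have h' : min δ₀ (κ / M) * M ≤ κ / M * M := mul_le_mul_of_nonneg_right h hM.le
  rw [div_mul_cancel₀ κ hM.ne'] at h'
  calc min δ₀ (κ / M) / 2 * M = min δ₀ (κ / M) * M / 2 := by ring
    _ ≤ κ / 2 := by linarith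

/-- δ₁ ≥ 0 when δ₀, κ ≥ 0 and M > 0. [folklore] -/
theorem delta1_nonneg {δ₀ κ M : ℝ} (hδ₀ : 0 ≤ δ₀) (hκ : 0 ≤ κ) (hM : 0 < M) : 0 ≤ delta1 δ₀ κ M := by
  unfold delta1
  have h : 0 ≤ min δ₀ (κ / M) := le_min hδ₀ (div_nonneg hκ hM.le)
  linarith

/-- *"a positive constant δ₁"* (p. 293): δ₁ > 0 when δ₀, κ, M > 0. [cite: Balaban1987RG1, (5.10) p.293] -/
theorem delta1_pos {δ₀ κ M : ℝ} (hδ₀ : 0 < δ₀) (hκ : 0 < κ) (hM : 0 < M) : 0 < delta1 δ₀ κ M := by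
  unfold delta1
  have h : 0 < min δ₀ (κ / M) := lt_min hδ₀ (div_pos hκ hM)
  linarith

/-! ## 2. Carriers: sites, distances to cubes and to localization domains -/

/-- The metric data of one scale that the polymer-sum argument uses (p. 257 [9]: the cubes □ ∈ π_j of the unit
lattice T₁^{(j)}, the localization domains X ∈ 𝐃_j as unions of cubes — in the tree the carrier `B12.CubeCover`
with `above □ = {X : X ⊃ □}`), over an abstract site set `Λ` (the unit lattice / torus T₁^{(j)}): the distances
dist(x, □) and dist(x, X) (nonnegative) and, for every site and domain, a cube OF the domain at which dist(x, X) is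
attained (dist(x, X) = min_{□⊂X} dist(x, □) for a finite union of cubes).  Abstract carrier (cell DIVERGENCE D-b03.7:
the cube geometry of π_j is not constructed here, cf. DIVERGENCE F5 of `B12.CubeCover`). [cite: Balaban1987RG1, §0 p.257] -/
structure SiteGeometry {S : LocDomainSys} (C : B12.CubeCover S) (Λ : Type*) where
  /-- dist(x, □) -/
  distC : Λ → C.Cube → ℝ
  /-- dist(x, X) -/
  distD : Λ → S.Dom → ℝ
  distC_nonneg : ∀ x c, 0 ≤ distC x c
  distD_nonneg : ∀ x X, 0 ≤ distD x X
  /-- a cube of `X` nearest to `x` -/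
  pick : Λ → S.Dom → C.Cube
  pick_mem : ∀ x X, X ∈ C.above (pick x X)
  distC_pick_le : ∀ x X, distC x (pick x X) ≤ distD x X

variable {S : LocDomainSys} {C : B12.CubeCover S} {Λ : Type*}

/-- **Geometry leaf** (p. 257 [9]: d_j(X)·M = the length of a shortest tree graph in X meeting all its cubes, hence
any two points of X are at distance ≤ M d_j(X) + 2·diam(□); with the nearest points of X to x and y and the triangle
inequality): ∣x − y∣ ≤ dist(x, X) + dist(y, X) + M(d_j(X) + c₁), `c₁` a constant depending on d and the chosen
lattice norm only.  A hypothesis (reduced to the diameter statement in `geomLeaf_of_diam`); print does not display it.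
[cite: Balaban1987RG1, §0 p.257] -/
def GeomLeaf (G : SiteGeometry C Λ) (ρ : Λ → Λ → ℝ) (M c₁ : ℝ) : Prop :=
  ∀ X x y, ρ x y ≤ G.distD x X + G.distD y X + M * (S.dj X + c₁)

/-- **Cube-sum leaf**: Σ_{□∈π_j} exp(−a·dist(x, □)) ≤ K₁ uniformly in the site x (for the cubes of side M of a
d-dimensional lattice and a > 0 an elementary lattice sum, K₁ = K₁(a, M, d)).  A hypothesis; print does not display it
(part of "yields", p. 293). [cite: Balaban1987RG1, (5.10) p.293] -/
def CubeSumLeaf (G : SiteGeometry C Λ) (a K₁ : ℝ) : Prop :=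
  ∀ x, ∑ c : C.Cube, Real.exp (-a * G.distC x c) ≤ K₁

/-- **Domain-sum (tree) leaf** at rate κ′: Σ_{X∈𝐃_j, X⊃□} exp(−κ′d_j(X)) ≤ K₀ for every cube — pp. 257–258 (0.26) /
[II] (1.26) *"Σ_{X∈𝐃_j, X⊃□′} exp(−κd_j(X)) ≤ O(1), (1.26) for κ sufficiently large"*; literally the hypothesis `hTree`
of `B12.chain026_holds` at one scale and `B12TreeDecay.CubeSystem.Ineq126Printed κ′ K₀` for a cube system (PROVED
there modulo the volume leaf; used here at κ′ = κ/2). [cite: Balaban1987RG1, (0.26) pp.257–258] -/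
def TreeLeaf (C : B12.CubeCover S) (κ' K₀ : ℝ) : Prop :=
  ∀ c : C.Cube, ∑ X ∈ C.above c, Real.exp (-κ' * S.dj X) ≤ K₀

/-- **Two-sided kernel bound** for the terms of (4.37): ∣𝐄^{(2)}_{μν}(X, x, y)∣ ≤ C_E e^{−κd_j(X)} e^{−δ₀dist(x,X)}
e^{−δ₀dist(y,X)} — the content of (1.18) + (4.3)–(4.5) + the p. 282 [34] remark *"if one of the functions B_i is
localized outside the domain X, then we have the additional exponential factor exp(−δ₀dist^{(ξ)}(X, supp B_i))"*
applied to both entries B₁ = δ_{(x,μ)}, B₂ = δ_{(y,ν)} of the r = 2 term (4.35) (dist^{(ξ)} ≥ the unit-lattice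
distance, ξ ≤ 1).  A hypothesis of (A); DERIVED from the (4.35)-shaped leaves in `kernelBound_of_repr435`.
[cite: Balaban1987RG1, (4.5) p.282 and (4.35) p.290] -/
def KernelBound (G : SiteGeometry C Λ) (E2 : S.Dom → Λ → Λ → ℝ) (CE κ δ₀ : ℝ) : Prop :=
  ∀ X x y, |E2 X x y| ≤
    CE * Real.exp (-κ * S.dj X) * Real.exp (-δ₀ * G.distD x X) * Real.exp (-δ₀ * G.distD y X)

/-! ## 3. The polymer-sum step ("The representation (4.37) yields …", p. 293) -/

/-- Regrouping a sum over domains by a chosen cube of each domain (the (0.26) move *"Σ_{X∈𝐃_j} ≤ Σ_{□∈π_j}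
Σ_{X∈𝐃_j, X⊃□}"* with a site-dependent choice of the cube and a cube weight): for f, w ≥ 0,
Σ_X f(X)·w(□(x,X)) ≤ Σ_□ w(□)·Σ_{X⊃□} f(X).  Finite combinatorics. [folklore] -/
theorem sum_pick_le (G : SiteGeometry C Λ) (f : S.Dom → ℝ) (hf : ∀ X, 0 ≤ f X) (w : C.Cube → ℝ)
    (hw : ∀ c, 0 ≤ w c) (x : Λ) :
    ∑ X, f X * w (G.pick x X) ≤ ∑ c : C.Cube, w c * ∑ X ∈ C.above c, f X := by
  classical
  rw [← Finset.sum_fiberwise Finset.univ (fun X => G.pick x X) (fun X => f X * w (G.pick x X))]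
  refine Finset.sum_le_sum fun c _ => ?_
  calc ∑ X ∈ Finset.univ.filter (fun X => G.pick x X = c), f X * w (G.pick x X)
      = ∑ X ∈ Finset.univ.filter (fun X => G.pick x X = c), f X * w c :=
        Finset.sum_congr rfl fun X hX => by rw [(Finset.mem_filter.1 hX).2]
    _ ≤ ∑ X ∈ C.above c, f X * w c := by
        refine Finset.sum_le_sum_of_subset_of_nonneg (fun X hX => ?_) fun X _ _ => mul_nonneg (hf X) (hw c)
        have h := (Finset.mem_filter.1 hX).2
        rw [← h]
        exact G.pick_mem x X
    _ = w c * ∑ X ∈ C.above c, f X := by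
        rw [Finset.mul_sum]
        exact Finset.sum_congr rfl fun X _ => mul_comm _ _

/-- The exponent bookkeeping of one term (the "½" of δ₁): with 0 ≤ δ₁ ≤ δ₀/2, δ₁M ≤ κ/2 and the geometry leaf,
C_E e^{−κd} e^{−δ₀dist(x,X)} e^{−δ₀dist(y,X)} ≤ C_E e^{δ₁Mc₁} e^{−δ₁∣x−y∣} · e^{−(κ/2)d} e^{−(δ₀/2)dist(x,□(x,X))}
(half of each rate pays for the decay in ∣x − y∣, the other half is kept for the domain and cube sums; the second
distance factor is simply dropped). [folklore] -/
theorem term_le (G : SiteGeometry C Λ) {ρ : Λ → Λ → ℝ} {CE κ δ₀ δ₁ M c₁ : ℝ} (hCE : 0 ≤ CE)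
    (hδ₁ : 0 ≤ δ₁) (hδ₁δ₀ : δ₁ ≤ δ₀ / 2) (hδ₁κ : δ₁ * M ≤ κ / 2) (hgeo : GeomLeaf G ρ M c₁)
    (X : S.Dom) (x y : Λ) :
    CE * Real.exp (-κ * S.dj X) * Real.exp (-δ₀ * G.distD x X) * Real.exp (-δ₀ * G.distD y X) ≤
      CE * Real.exp (δ₁ * M * c₁) * Real.exp (-δ₁ * ρ x y) *
        (Real.exp (-(κ / 2) * S.dj X) * Real.exp (-(δ₀ / 2) * G.distC x (G.pick x X))) := by
  have hd := S.dj_nonneg X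
  have ha := G.distD_nonneg x X
  have hb := G.distD_nonneg y X
  have hp := G.distC_pick_le x X
  have hδ₀ : 0 ≤ δ₀ := by linarith
  have h1 : δ₁ * G.distD x X ≤ δ₀ / 2 * G.distD x X := mul_le_mul_of_nonneg_right hδ₁δ₀ ha
  have h2 : δ₁ * G.distD y X ≤ δ₀ * G.distD y X := mul_le_mul_of_nonneg_right (by linarith) hb
  have h3 : δ₁ * M * S.dj X ≤ κ / 2 * S.dj X := mul_le_mul_of_nonneg_right hδ₁κ hd
  have h4 : δ₀ / 2 * G.distC x (G.pick x X) ≤ δ₀ / 2 * G.distD x X :=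
    mul_le_mul_of_nonneg_left hp (by linarith)
  have h5 : δ₁ * ρ x y ≤ δ₁ * G.distD x X + δ₁ * G.distD y X + δ₁ * M * S.dj X + δ₁ * M * c₁ :=
    calc δ₁ * ρ x y ≤ δ₁ * (G.distD x X + G.distD y X + M * (S.dj X + c₁)) :=
          mul_le_mul_of_nonneg_left (hgeo X x y) hδ₁
      _ = δ₁ * G.distD x X + δ₁ * G.distD y X + δ₁ * M * S.dj X + δ₁ * M * c₁ := by ring
  have key : -κ * S.dj X + -δ₀ * G.distD x X + -δ₀ * G.distD y X ≤
      δ₁ * M * c₁ + -δ₁ * ρ x y + (-(κ / 2) * S.dj X + -(δ₀ / 2) * G.distC x (G.pick x X)) := by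
    linarith
  calc CE * Real.exp (-κ * S.dj X) * Real.exp (-δ₀ * G.distD x X) * Real.exp (-δ₀ * G.distD y X)
      = CE * Real.exp (-κ * S.dj X + -δ₀ * G.distD x X + -δ₀ * G.distD y X) := by
        rw [Real.exp_add, Real.exp_add]; ring
    _ ≤ CE * Real.exp (δ₁ * M * c₁ + -δ₁ * ρ x y +
          (-(κ / 2) * S.dj X + -(δ₀ / 2) * G.distC x (G.pick x X))) :=
        mul_le_mul_of_nonneg_left (Real.exp_le_exp.2 key) hCE
    _ = CE * Real.exp (δ₁ * M * c₁) * Real.exp (-δ₁ * ρ x y) *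
          (Real.exp (-(κ / 2) * S.dj X) * Real.exp (-(δ₀ / 2) * G.distC x (G.pick x X))) := by
        rw [Real.exp_add, Real.exp_add, Real.exp_add]; ring

/-- The domain and cube sums: Σ_X e^{−(κ/2)d_j(X)} e^{−(δ₀/2)dist(x,□(x,X))} ≤ K₀K₁ from the tree leaf at κ/2 and the
cube-sum leaf at δ₀/2 (regroup by the nearest cube, sum the domains above each cube, then the cubes). [folklore] -/
theorem weight_sum_le (G : SiteGeometry C Λ) {κ δ₀ K₀ K₁ : ℝ} (hK₀ : 0 ≤ K₀)
    (hcube : CubeSumLeaf G (δ₀ / 2) K₁) (htree : TreeLeaf C (κ / 2) K₀) (x : Λ) :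
    ∑ X, Real.exp (-(κ / 2) * S.dj X) * Real.exp (-(δ₀ / 2) * G.distC x (G.pick x X)) ≤ K₀ * K₁ := by
  have h1 := sum_pick_le G (fun X => Real.exp (-(κ / 2) * S.dj X)) (fun X => (Real.exp_pos _).le)
    (fun c => Real.exp (-(δ₀ / 2) * G.distC x c)) (fun c => (Real.exp_pos _).le) x
  have h2 : ∑ c : C.Cube, Real.exp (-(δ₀ / 2) * G.distC x c) * ∑ X ∈ C.above c, Real.exp (-(κ / 2) * S.dj X) ≤
      ∑ c : C.Cube, Real.exp (-(δ₀ / 2) * G.distC x c) * K₀ :=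
    Finset.sum_le_sum fun c _ => mul_le_mul_of_nonneg_left (htree c) (Real.exp_pos _).le
  have h3 : ∑ c : C.Cube, Real.exp (-(δ₀ / 2) * G.distC x c) * K₀ ≤ K₀ * K₁ := by
    rw [← Finset.sum_mul, mul_comm]
    exact mul_le_mul_of_nonneg_left (hcube x) hK₀
  exact h1.trans (h2.trans h3)

/-- **(A) The polymer sum.**  Under the two-sided kernel bound, the geometry leaf, the cube-sum leaf at δ₀/2 and the
domain-sum leaf at κ/2, for every δ₁ with 0 ≤ δ₁ ≤ δ₀/2, δ₁M ≤ κ/2: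
Σ_{X∈𝐃_j} ∣𝐄^{(2)}(X, x, y)∣ ≤ C_E e^{δ₁Mc₁} K₀ K₁ e^{−δ₁∣x − y∣} — the standard argument behind *"The representation
(4.37) yields the following inequality (5.10)"* (p. 293 [45]), kernel-checked. [cite: Balaban1987RG1, (5.10) p.293] -/
theorem sum_abs_le (G : SiteGeometry C Λ) {ρ : Λ → Λ → ℝ} {E2 : S.Dom → Λ → Λ → ℝ}
    {CE κ δ₀ δ₁ M c₁ K₀ K₁ : ℝ} (hCE : 0 ≤ CE) (hK₀ : 0 ≤ K₀)
    (hδ₁ : 0 ≤ δ₁) (hδ₁δ₀ : δ₁ ≤ δ₀ / 2) (hδ₁κ : δ₁ * M ≤ κ / 2)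
    (hE : KernelBound G E2 CE κ δ₀) (hgeo : GeomLeaf G ρ M c₁)
    (hcube : CubeSumLeaf G (δ₀ / 2) K₁) (htree : TreeLeaf C (κ / 2) K₀) (x y : Λ) :
    ∑ X, |E2 X x y| ≤ CE * Real.exp (δ₁ * M * c₁) * K₀ * K₁ * Real.exp (-δ₁ * ρ x y) := by
  have step1 : ∑ X, |E2 X x y| ≤ ∑ X, CE * Real.exp (δ₁ * M * c₁) * Real.exp (-δ₁ * ρ x y) *
      (Real.exp (-(κ / 2) * S.dj X) * Real.exp (-(δ₀ / 2) * G.distC x (G.pick x X))) :=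
    Finset.sum_le_sum fun X _ => (hE X x y).trans (term_le G hCE hδ₁ hδ₁δ₀ hδ₁κ hgeo X x y)
  rw [← Finset.mul_sum] at step1
  have step2 := weight_sum_le G hK₀ hcube htree x (κ := κ) (δ₀ := δ₀)
  have hc : 0 ≤ CE * Real.exp (δ₁ * M * c₁) * Real.exp (-δ₁ * ρ x y) :=
    mul_nonneg (mul_nonneg hCE (Real.exp_pos _).le) (Real.exp_pos _).le
  calc ∑ X, |E2 X x y|
      ≤ CE * Real.exp (δ₁ * M * c₁) * Real.exp (-δ₁ * ρ x y) *
          ∑ X, Real.exp (-(κ / 2) * S.dj X) * Real.exp (-(δ₀ / 2) * G.distC x (G.pick x X)) := step1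
    _ ≤ CE * Real.exp (δ₁ * M * c₁) * Real.exp (-δ₁ * ρ x y) * (K₀ * K₁) :=
        mul_le_mul_of_nonneg_left step2 hc
    _ = CE * Real.exp (δ₁ * M * c₁) * K₀ * K₁ * Real.exp (-δ₁ * ρ x y) := by ring

/-- **(A′) (5.10) on one system**: the two-point function Π(x, y) = Σ_{X∈𝐃_j} 𝐄^{(2)}(X, x, y) of (4.37) satisfies
∣Π(x, y)∣ ≤ C_E e^{δ₁Mc₁} K₀K₁ · e^{−δ₁∣x − y∣} for every admissible δ₁ (0 ≤ δ₁ ≤ δ₀/2, δ₁M ≤ κ/2).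
[cite: Balaban1987RG1, (5.10) p.293] -/
theorem abs_twoPoint_le (G : SiteGeometry C Λ) {ρ : Λ → Λ → ℝ} {E2 : S.Dom → Λ → Λ → ℝ}
    {CE κ δ₀ δ₁ M c₁ K₀ K₁ : ℝ} (hCE : 0 ≤ CE) (hK₀ : 0 ≤ K₀)
    (hδ₁ : 0 ≤ δ₁) (hδ₁δ₀ : δ₁ ≤ δ₀ / 2) (hδ₁κ : δ₁ * M ≤ κ / 2)
    (hE : KernelBound G E2 CE κ δ₀) (hgeo : GeomLeaf G ρ M c₁)
    (hcube : CubeSumLeaf G (δ₀ / 2) K₁) (htree : TreeLeaf C (κ / 2) K₀) (x y : Λ) :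
    |∑ X, E2 X x y| ≤ CE * Real.exp (δ₁ * M * c₁) * K₀ * K₁ * Real.exp (-δ₁ * ρ x y) :=
  (Finset.abs_sum_le_sum_abs _ _).trans (sum_abs_le G hCE hK₀ hδ₁ hδ₁δ₀ hδ₁κ hE hgeo hcube htree x y)

/-- **(A″) with the printed δ₁ = ½ min{δ₀, κM⁻¹}** (p. 293 "e.g."): for δ₀, κ ≥ 0 and M > 0 the printed constant is
admissible, so ∣Π(x, y)∣ ≤ C_E e^{δ₁Mc₁} K₀K₁ e^{−δ₁∣x − y∣} with δ₁ = `delta1 δ₀ κ M`. [cite: Balaban1987RG1, (5.10) p.293] -/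
theorem abs_twoPoint_le_delta1 (G : SiteGeometry C Λ) {ρ : Λ → Λ → ℝ} {E2 : S.Dom → Λ → Λ → ℝ}
    {CE κ δ₀ M c₁ K₀ K₁ : ℝ} (hCE : 0 ≤ CE) (hK₀ : 0 ≤ K₀) (hδ₀ : 0 ≤ δ₀) (hκ : 0 ≤ κ) (hM : 0 < M)
    (hE : KernelBound G E2 CE κ δ₀) (hgeo : GeomLeaf G ρ M c₁)
    (hcube : CubeSumLeaf G (δ₀ / 2) K₁) (htree : TreeLeaf C (κ / 2) K₀) (x y : Λ) :
    |∑ X, E2 X x y| ≤ CE * Real.exp (delta1 δ₀ κ M * M * c₁) * K₀ * K₁ *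
      Real.exp (-(delta1 δ₀ κ M) * ρ x y) :=
  abs_twoPoint_le G hCE hK₀ (delta1_nonneg hδ₀ hκ hM) (delta1_le_half δ₀ κ M) (delta1_mul_le δ₀ κ hM)
    hE hgeo hcube htree x y

/-! ## 4. (B) The kernel bound from the representation (4.35), the Cauchy estimate and the minimizer decay -/

/-- **(B)** p. 290 [42] (4.35) *"𝐄^{(2)}(X) = ⟨(δ²/δ𝐇²)𝐄(X, 1), H_j(□₀), H_j(□₀)⟩"* read componentwise: the kernel
𝐄^{(2)}_{μν}(X, x, y) is the value of a form `Q X` (the second 𝐇-derivative of 𝐄(X, ·) at 𝐇 = 0, depending on 𝐇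
restricted to X by the locality of (1.7)) on the pair (h_X(x), h_X(y)) of restrictions to X of the linearized minimizer
applied to the unit fields at (x, μ), (y, ν) (`hrepr`); the Cauchy estimate from (1.18) on the domain (4.4) gives
∣Q_X(a, b)∣ ≤ A e^{−κd_j(X)} ‖a‖‖b‖ (`hQ`; (4.3)–(4.5): A = (2n²/α₂)ⁿE₀ at n = 2); p. 282 [34] gives
‖h_X(x)‖ ≤ B₃ e^{−δ₀dist(x,X)} (`hh`, [15] Sect. G).  THEN the two-sided kernel bound holds with C_E = A·B₃² (for
n = 2 this is the printed constant (8B₃α₂⁻¹)²E₀ of (4.5)).  Elementary. [cite: Balaban1987RG1, (4.35) p.290 and (4.5) p.282] -/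
theorem kernelBound_of_repr435 (G : SiteGeometry C Λ) {V : S.Dom → Type*}
    [∀ X, SeminormedAddCommGroup (V X)] (Q : (X : S.Dom) → V X → V X → ℝ) (h : (X : S.Dom) → Λ → V X)
    (E2 : S.Dom → Λ → Λ → ℝ) {A B₃ κ δ₀ : ℝ} (hA : 0 ≤ A) (hB₃ : 0 ≤ B₃)
    (hrepr : ∀ X x y, E2 X x y = Q X (h X x) (h X y))
    (hQ : ∀ X a b, |Q X a b| ≤ A * Real.exp (-κ * S.dj X) * ‖a‖ * ‖b‖)
    (hh : ∀ X x, ‖h X x‖ ≤ B₃ * Real.exp (-δ₀ * G.distD x X)) :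
    KernelBound G E2 (A * B₃ ^ 2) κ δ₀ := by
  intro X x y
  rw [hrepr]
  have h0 : 0 ≤ A * Real.exp (-κ * S.dj X) := mul_nonneg hA (Real.exp_pos _).le
  calc |Q X (h X x) (h X y)| ≤ A * Real.exp (-κ * S.dj X) * ‖h X x‖ * ‖h X y‖ := hQ X _ _
    _ ≤ A * Real.exp (-κ * S.dj X) * (B₃ * Real.exp (-δ₀ * G.distD x X)) *
          (B₃ * Real.exp (-δ₀ * G.distD y X)) := by
        have e1 := hh X x
        have e2 := hh X y
        have n1 := norm_nonneg (h X x)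
        have n2 := norm_nonneg (h X y)
        calc A * Real.exp (-κ * S.dj X) * ‖h X x‖ * ‖h X y‖
            ≤ A * Real.exp (-κ * S.dj X) * (B₃ * Real.exp (-δ₀ * G.distD x X)) * ‖h X y‖ :=
              mul_le_mul_of_nonneg_right (mul_le_mul_of_nonneg_left e1 h0) n2
          _ ≤ A * Real.exp (-κ * S.dj X) * (B₃ * Real.exp (-δ₀ * G.distD x X)) *
                (B₃ * Real.exp (-δ₀ * G.distD y X)) :=
              mul_le_mul_of_nonneg_left e2 (mul_nonneg h0 (mul_nonneg hB₃ (Real.exp_pos _).le))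
    _ = A * B₃ ^ 2 * Real.exp (-κ * S.dj X) * Real.exp (-δ₀ * G.distD x X) *
          Real.exp (-δ₀ * G.distD y X) := by ring

/-- **(A)+(B) assembled with the printed δ₁**: from the (4.35)-shaped leaves, the geometry leaf, the cube-sum leaf
and the domain-sum leaf, ∣Σ_X 𝐄^{(2)}(X, x, y)∣ ≤ A B₃² e^{δ₁Mc₁} K₀K₁ e^{−δ₁∣x − y∣}, δ₁ = ½ min{δ₀, κM⁻¹} — the
"O(1)E₀" of (5.10) made explicit (A ∝ E₀). [cite: Balaban1987RG1, (5.10) p.293] -/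
theorem abs_twoPoint_le_of_repr435 (G : SiteGeometry C Λ) {ρ : Λ → Λ → ℝ} {V : S.Dom → Type*}
    [∀ X, SeminormedAddCommGroup (V X)] (Q : (X : S.Dom) → V X → V X → ℝ) (h : (X : S.Dom) → Λ → V X)
    (E2 : S.Dom → Λ → Λ → ℝ) {A B₃ κ δ₀ M c₁ K₀ K₁ : ℝ} (hA : 0 ≤ A) (hB₃ : 0 ≤ B₃) (hK₀ : 0 ≤ K₀)
    (hδ₀ : 0 ≤ δ₀) (hκ : 0 ≤ κ) (hM : 0 < M)
    (hrepr : ∀ X x y, E2 X x y = Q X (h X x) (h X y))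
    (hQ : ∀ X a b, |Q X a b| ≤ A * Real.exp (-κ * S.dj X) * ‖a‖ * ‖b‖)
    (hh : ∀ X x, ‖h X x‖ ≤ B₃ * Real.exp (-δ₀ * G.distD x X))
    (hgeo : GeomLeaf G ρ M c₁) (hcube : CubeSumLeaf G (δ₀ / 2) K₁) (htree : TreeLeaf C (κ / 2) K₀) (x y : Λ) :
    |∑ X, E2 X x y| ≤ A * B₃ ^ 2 * Real.exp (delta1 δ₀ κ M * M * c₁) * K₀ * K₁ *
      Real.exp (-(delta1 δ₀ κ M) * ρ x y) :=
  abs_twoPoint_le_delta1 G (mul_nonneg hA (sq_nonneg B₃)) hK₀ hδ₀ hκ hM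
    (kernelBound_of_repr435 G Q h E2 hA hB₃ hrepr hQ hh) hgeo hcube htree x y

/-! ## 5. (C) The domain-sum leaf discharged by `B12TreeDecay` (modulo the published volume leaf) -/

/-- **(C)** For the cover induced by a cube system (domains = connected finite families of cubes, p. 257), the
domain-sum leaf at rate κ/2 HOLDS with K₀ = `B12TreeDecay.K₀ c₀ Δ` as soon as κ/2 ≥ κ₀(c₀, Δ) — by the tree theorem
`B12TreeDecay.hTree_of_volumeLeaf` (degree bound Δ of the cube adjacency, volume leaf ∣X∣_M ≤ c₀(1 + d_j(X)) =
[Dimock2013BalabanII] Lemma E.1).  This is where the unprinted restriction "κ large w.r.t. the domain entropy" (cell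
H-ord.11) becomes an explicit hypothesis. [cite: Balaban1987RG1, (0.26) pp.257–258] -/
theorem treeLeaf_of_volumeLeaf (Gc : B12TreeDecay.CubeSystem S) {Δ : ℕ} (hΔ : Gc.DegreeLE Δ) {c₀ : ℝ}
    (hV : Gc.VolumeLeaf c₀) {κ : ℝ} (hκ : B12TreeDecay.kappa₀ c₀ Δ ≤ κ / 2) :
    TreeLeaf Gc.toCubeCover (κ / 2) (B12TreeDecay.K₀ c₀ Δ) :=
  B12TreeDecay.hTree_of_volumeLeaf Gc hΔ hV hκ

/-- **(A)+(B)+(C)**: (5.10) on one system with the domain sum discharged — hypotheses: the (4.35)-shaped leaves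
(`hrepr`, `hQ`, `hh`), the geometry and cube-sum leaves, the cube-adjacency degree bound, the published volume leaf,
and κ ≥ 2κ₀(c₀, Δ); conclusion ∣Σ_X 𝐄^{(2)}(X, x, y)∣ ≤ A B₃² e^{δ₁Mc₁} K₀(c₀,Δ) K₁ e^{−δ₁∣x − y∣},
δ₁ = ½ min{δ₀, κM⁻¹}. [cite: Balaban1987RG1, (5.10) p.293] -/
theorem abs_twoPoint_le_of_volumeLeaf (Gc : B12TreeDecay.CubeSystem S) (G : SiteGeometry Gc.toCubeCover Λ)
    {ρ : Λ → Λ → ℝ} {V : S.Dom → Type*} [∀ X, SeminormedAddCommGroup (V X)]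
    (Q : (X : S.Dom) → V X → V X → ℝ) (h : (X : S.Dom) → Λ → V X) (E2 : S.Dom → Λ → Λ → ℝ)
    {A B₃ κ δ₀ M c₁ K₁ c₀ : ℝ} {Δ : ℕ} (hA : 0 ≤ A) (hB₃ : 0 ≤ B₃) (hδ₀ : 0 ≤ δ₀) (hM : 0 < M)
    (hΔ : Gc.DegreeLE Δ) (hc₀ : 0 ≤ c₀) (hV : Gc.VolumeLeaf c₀) (hκ : B12TreeDecay.kappa₀ c₀ Δ ≤ κ / 2)
    (hrepr : ∀ X x y, E2 X x y = Q X (h X x) (h X y))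
    (hQ : ∀ X a b, |Q X a b| ≤ A * Real.exp (-κ * S.dj X) * ‖a‖ * ‖b‖)
    (hh : ∀ X x, ‖h X x‖ ≤ B₃ * Real.exp (-δ₀ * G.distD x X))
    (hgeo : GeomLeaf G ρ M c₁) (hcube : CubeSumLeaf G (δ₀ / 2) K₁) (x y : Λ) :
    |∑ X, E2 X x y| ≤ A * B₃ ^ 2 * Real.exp (delta1 δ₀ κ M * M * c₁) * B12TreeDecay.K₀ c₀ Δ * K₁ *
      Real.exp (-(delta1 δ₀ κ M) * ρ x y) := by
  have hκ0 : 0 ≤ κ := by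
    have := B12TreeDecay.kappa₀_nonneg hc₀ Δ
    linarith
  exact abs_twoPoint_le_of_repr435 G Q h E2 hA hB₃ (B12TreeDecay.K₀_pos c₀ Δ).le hδ₀ hκ0 hM hrepr hQ hh
    hgeo hcube (treeLeaf_of_volumeLeaf Gc hΔ hV hκ) x y

/-! ## 6. (D) The geometry leaf from the diameter bound -/

/-- **(D)** p. 257 [9]: if any two sites of a domain are within M(d_j(X) + c₁) of each other (both lie in cubes met by
a shortest tree graph of length M d_j(X); c₁ = 2·diam(□)/M-type constant), dist(x, X) is (at most) attained at a site
of X, and ∣·∣ is symmetric with the triangle inequality, THEN the geometry leaf holds.  Elementary. [cite: Balaban1987RG1, §0 p.257] -/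
theorem geomLeaf_of_diam (G : SiteGeometry C Λ) {ρ : Λ → Λ → ℝ} (mem : Λ → S.Dom → Prop) {M c₁ : ℝ}
    (ρ_symm : ∀ a b, ρ a b = ρ b a) (ρ_triangle : ∀ a b c, ρ a c ≤ ρ a b + ρ b c)
    (hdiam : ∀ X p q, mem p X → mem q X → ρ p q ≤ M * (S.dj X + c₁))
    (hnear : ∀ x X, ∃ p, mem p X ∧ ρ x p ≤ G.distD x X) : GeomLeaf G ρ M c₁ := by
  intro X x y
  obtain ⟨p, hp, hxp⟩ := hnear x X
  obtain ⟨q, hq, hyq⟩ := hnear y X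
  have h1 := ρ_triangle x p y
  have h2 := ρ_triangle p q y
  have h3 := hdiam X p q hp hq
  rw [ρ_symm q y] at h2
  linarith

/-! ## 7. (E) The passage to the infinite unit lattice ((5.1), (5.11)) and `B12Sec2to5.Decay510` -/

/-- **(E)** A pointwise limit of kernels obeying ∣P_n(z)∣ ≤ C e^{−δ₁∣z∣₁} (eventually in n, for each z) obeys it:
the (5.10) bound passes through the limit (5.1) *"lim_{T₁^{(j)}↗Z⁴}"* / (5.11) to the kernel on ℤᵈ, landing in the
tree's `B12Sec2to5.Decay510`.  Closedness of `≤`. [cite: Balaban1987RG1, (5.1) p.292 and (5.10) p.293] -/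
theorem decay510_of_tendsto {d : ℕ} {P : (Fin d → ℤ) → ℝ} {C δ₁ : ℝ} (Pn : ℕ → (Fin d → ℤ) → ℝ)
    (hlim : ∀ z, Tendsto (fun n => Pn n z) atTop (𝓝 (P z)))
    (hbd : ∀ z, ∀ᶠ n in atTop, |Pn n z| ≤ C * Real.exp (-δ₁ * B12Sec2to5.l1 z)) :
    B12Sec2to5.Decay510 P C δ₁ :=
  fun z => le_of_tendsto ((continuous_abs.tendsto (P z)).comp (hlim z)) (hbd z)

/-- **(E′) (5.10) on ℤᵈ from a family of finite systems**: tori (site sets Λ_n with distances ρ_n and two-point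
functions Π_n obeying ∣Π_n(x, y)∣ ≤ C e^{−δ₁ρ_n(x,y)}), embeddings e_n of ℤᵈ with ρ_n(e_n 0, e_n z) = ∣z∣₁ for n large
(z fixed), and the limit P(z) = lim_n Π_n(e_n 0, e_n z) of (5.1)/(5.8) ⇒ `Decay510 P C δ₁`.
[cite: Balaban1987RG1, (5.1) p.292 and (5.10) p.293] -/
theorem decay510_of_family {d : ℕ} (Λn : ℕ → Type*) (ρn : (n : ℕ) → Λn n → Λn n → ℝ)
    (Pin : (n : ℕ) → Λn n → Λn n → ℝ) (e : (n : ℕ) → (Fin d → ℤ) → Λn n) {C δ₁ : ℝ}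
    (P : (Fin d → ℤ) → ℝ) (hPi : ∀ n x y, |Pin n x y| ≤ C * Real.exp (-δ₁ * ρn n x y))
    (hρ : ∀ z, ∀ᶠ n in atTop, ρn n (e n 0) (e n z) = B12Sec2to5.l1 z)
    (hlim : ∀ z, Tendsto (fun n => Pin n (e n 0) (e n z)) atTop (𝓝 (P z))) :
    B12Sec2to5.Decay510 P C δ₁ := by
  refine decay510_of_tendsto (fun n z => Pin n (e n 0) (e n z)) hlim fun z => ?_
  filter_upwards [hρ z] with n hn
  rw [← hn]
  exact hPi n _ _

/-- **The whole chain for the tree hypothesis `Decay510`** (census row G-B12s-15): a family of finite systems each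
satisfying the leaves of (A)+(B) with the SAME constants (uniformity in the volume, as in (5.1)), embeddings of ℤᵈ
isometric on larger and larger windows, and the limit (5.1) ⇒ `B12Sec2to5.Decay510 P (A B₃² e^{δ₁Mc₁} K₀ K₁) δ₁` with
the printed δ₁ = ½ min{δ₀, κM⁻¹} — so the β′-edge `B12Sec2to5.betaUpper_of_decay510` applies with these constants.
[cite: Balaban1987RG1, (5.10) p.293] -/
theorem decay510_of_leaves {d : ℕ} (Sn : ℕ → LocDomainSys) (Cn : (n : ℕ) → B12.CubeCover (Sn n))
    (Λn : ℕ → Type*) (Gn : (n : ℕ) → SiteGeometry (Cn n) (Λn n)) (ρn : (n : ℕ) → Λn n → Λn n → ℝ)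
    (Vn : (n : ℕ) → (Sn n).Dom → Type*) [∀ n X, SeminormedAddCommGroup (Vn n X)]
    (Qn : (n : ℕ) → (X : (Sn n).Dom) → Vn n X → Vn n X → ℝ) (hn : (n : ℕ) → (X : (Sn n).Dom) → Λn n → Vn n X)
    (E2n : (n : ℕ) → (Sn n).Dom → Λn n → Λn n → ℝ) (e : (n : ℕ) → (Fin d → ℤ) → Λn n)
    (P : (Fin d → ℤ) → ℝ) {A B₃ κ δ₀ M c₁ K₀ K₁ : ℝ} (hA : 0 ≤ A) (hB₃ : 0 ≤ B₃) (hK₀ : 0 ≤ K₀)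
    (hδ₀ : 0 ≤ δ₀) (hκ : 0 ≤ κ) (hM : 0 < M)
    (hrepr : ∀ n X x y, E2n n X x y = Qn n X (hn n X x) (hn n X y))
    (hQ : ∀ n X a b, |Qn n X a b| ≤ A * Real.exp (-κ * (Sn n).dj X) * ‖a‖ * ‖b‖)
    (hh : ∀ n X x, ‖hn n X x‖ ≤ B₃ * Real.exp (-δ₀ * (Gn n).distD x X))
    (hgeo : ∀ n, GeomLeaf (Gn n) (ρn n) M c₁) (hcube : ∀ n, CubeSumLeaf (Gn n) (δ₀ / 2) K₁)
    (htree : ∀ n, TreeLeaf (Cn n) (κ / 2) K₀)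
    (hρ : ∀ z, ∀ᶠ n in atTop, ρn n (e n 0) (e n z) = B12Sec2to5.l1 z)
    (hlim : ∀ z, Tendsto (fun n => ∑ X, E2n n X (e n 0) (e n z)) atTop (𝓝 (P z))) :
    B12Sec2to5.Decay510 P (A * B₃ ^ 2 * Real.exp (delta1 δ₀ κ M * M * c₁) * K₀ * K₁) (delta1 δ₀ κ M) :=
  decay510_of_family Λn ρn (fun n x y => ∑ X, E2n n X x y) e P
    (fun n x y => abs_twoPoint_le_of_repr435 (Gn n) (Qn n) (hn n) (E2n n) hA hB₃ hK₀ hδ₀ hκ hM (hrepr n)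
      (hQ n) (hh n) (hgeo n) (hcube n) (htree n) x y) hρ hlim

/-! ## 8. (F) The Cauchy bilinear estimate of (4.3)–(4.5) at r = n = 2, kernel-derived from analyticity -/

section Cauchy

open Metric

variable {W : Type*} [NormedAddCommGroup W] [NormedSpace ℂ W]

/-- p. 281 [33] (4.3), second form at r = 2: the mixed derivative ∂²/∂τ₁∂τ₂ E(τ₁a + τ₂b)∣_{τ=0} of a function E of
the configuration 𝐀 (here: an element of a complex normed space `W`, the norm being the max-norm of (4.4)) along the
pair (a, b) — typed as ∂_τ [DE(τb) a]∣_{τ=0} (the inner τ₁-derivative written as the Fréchet derivative, `deriv_line`).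
For (4.35) one takes a = h_X(x), b = h_X(y). [cite: Balaban1987RG1, (4.3) p.281] -/
noncomputable def mixedDeriv (E : W → ℂ) (a b : W) : ℂ :=
  deriv (fun τ : ℂ => (fderiv ℂ E (τ • b)) a) 0

/-- The inner τ₁-derivative of (4.3): d/dτ E(τa + p)∣_{τ=0} = DE(p) a at a point p of differentiability.  Chain rule.
[cite: Balaban1987RG1, (4.3) p.281] -/
theorem deriv_line (E : W → ℂ) (a p : W) (hd : DifferentiableAt ℂ E p) :
    deriv (fun τ : ℂ => E (τ • a + p)) 0 = fderiv ℂ E p a := by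
  have hφ : HasDerivAt (fun τ : ℂ => τ • a + p) a 0 := by
    simpa using ((hasDerivAt_id (0 : ℂ)).smul_const a).add_const p
  have h := HasFDerivAt.comp_hasDerivAt_of_eq (hl := hd.hasFDerivAt) (hf := hφ) (hy := by simp)
  exact h.deriv

/-- **(F) The Cauchy estimate behind (4.5), r = n = 2, on a closed sub-ball.**  IF E is analytic on the open ball
‖𝐀‖ < α ((4.4), p. 281: *"Thus it is defined and analytic on the space of configurations 𝐀 satisfying … < α₂"*) and
∣E∣ ≤ S on the closed ball of radius ρ < α (the bound (1.18) p. 263 *"∣𝐄^{(j)}(X, g_{j−1}, 𝐔, 𝐉)∣ ≤ E₀ exp(−κd_j(X))"*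
on that domain), THEN ∣∂²/∂τ₁∂τ₂ E(τ₁a + τ₂b)∣₀∣ ≤ 4Sρ⁻²‖a‖‖b‖: the third form of (4.3) *"Π_p (1/2πi)∮ dτ_p/τ_p² 𝐄^{(j)}(…)"*
estimated on the circles ∣τ₁∣ = ρ/(2‖a‖), ∣τ₂∣ = ρ/(2‖b‖) (so that ‖τ₁a + τ₂b‖ ≤ ρ), each circle costing a factor
radius⁻¹ (Mathlib `Complex.norm_deriv_le_of_forall_mem_sphere_norm_le`, applied in τ₁ at fixed τ₂ and then in τ₂ to
τ ↦ DE(τb) a, which is differentiable because the Fréchet derivative of an analytic function is analytic).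
[cite: Balaban1987RG1, (4.3)-(4.5) pp.281-282] -/
theorem norm_mixedDeriv_le_of_closedBall {E : W → ℂ} {α ρ S : ℝ}
    (hE : AnalyticOnNhd ℂ E (ball 0 α)) (hρ : 0 < ρ) (hρα : ρ < α)
    (hS : ∀ v ∈ closedBall (0 : W) ρ, ‖E v‖ ≤ S) (a b : W) :
    ‖mixedDeriv E a b‖ ≤ 4 * S / ρ ^ 2 * ‖a‖ * ‖b‖ := by
  have hS0 : 0 ≤ S := (norm_nonneg _).trans (hS 0 (mem_closedBall_self hρ.le))
  have hball : closedBall (0 : W) ρ ⊆ ball 0 α := closedBall_subset_ball hρα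
  have hdiffE : ∀ v ∈ closedBall (0 : W) ρ, DifferentiableAt ℂ E v :=
    fun v hv => (hE v (hball hv)).differentiableAt
  by_cases ha : a = 0
  · subst ha
    have : mixedDeriv E 0 b = 0 := by simp [mixedDeriv]
    rw [this, norm_zero]; positivity
  by_cases hb : b = 0
  · subst hb
    have : mixedDeriv E a 0 = 0 := by simp [mixedDeriv]
    rw [this, norm_zero]; positivity
  have ha' : 0 < ‖a‖ := norm_pos_iff.2 ha
  have hb' : 0 < ‖b‖ := norm_pos_iff.2 hb
  set r₁ : ℝ := ρ / (2 * ‖a‖) with hr₁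
  set r₂ : ℝ := ρ / (2 * ‖b‖) with hr₂
  have hr₁0 : 0 < r₁ := div_pos hρ (by positivity)
  have hr₂0 : 0 < r₂ := div_pos hρ (by positivity)
  have hin : ∀ τ₁ τ₂ : ℂ, ‖τ₁‖ ≤ r₁ → ‖τ₂‖ ≤ r₂ → τ₁ • a + τ₂ • b ∈ closedBall (0 : W) ρ := by
    intro τ₁ τ₂ h1 h2
    rw [mem_closedBall, dist_zero_right]
    calc ‖τ₁ • a + τ₂ • b‖ ≤ ‖τ₁ • a‖ + ‖τ₂ • b‖ := norm_add_le _ _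
      _ = ‖τ₁‖ * ‖a‖ + ‖τ₂‖ * ‖b‖ := by rw [norm_smul, norm_smul]
      _ ≤ r₁ * ‖a‖ + r₂ * ‖b‖ := by gcongr
      _ = ρ := by rw [hr₁, hr₂]; field_simp; ring
  -- the inner Cauchy estimate (circle in τ₁ at fixed τ₂): ‖DE(τ₂b) a‖ ≤ S / r₁ for ‖τ₂‖ ≤ r₂
  have inner : ∀ τ₂ : ℂ, ‖τ₂‖ ≤ r₂ → ‖(fderiv ℂ E (τ₂ • b)) a‖ ≤ S / r₁ := by
    intro τ₂ h2
    have hp : τ₂ • b ∈ closedBall (0 : W) ρ := by simpa using hin 0 τ₂ (by simpa using hr₁0.le) h2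
    rw [← deriv_line E a (τ₂ • b) (hdiffE _ hp)]
    refine Complex.norm_deriv_le_of_forall_mem_sphere_norm_le hr₁0 ?_ ?_
    · refine DifferentiableOn.diffContOnCl ?_
      rw [closure_ball (0 : ℂ) hr₁0.ne']
      intro τ₁ h1
      rw [mem_closedBall, dist_zero_right] at h1
      have hd := hdiffE _ (hin τ₁ τ₂ h1 h2)
      have hlin : DifferentiableAt ℂ (fun τ : ℂ => τ • a + τ₂ • b) τ₁ :=
        (differentiableAt_id.smul_const a).add_const _
      exact (hd.comp τ₁ hlin).differentiableWithinAt
    · intro τ₁ h1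
      rw [mem_sphere, dist_zero_right] at h1
      exact hS _ (hin τ₁ τ₂ h1.le h2)
  -- the outer Cauchy estimate (circle in τ₂)
  have outer : ‖mixedDeriv E a b‖ ≤ S / r₁ / r₂ := by
    unfold mixedDeriv
    refine Complex.norm_deriv_le_of_forall_mem_sphere_norm_le hr₂0 ?_ ?_
    · refine DifferentiableOn.diffContOnCl ?_
      rw [closure_ball (0 : ℂ) hr₂0.ne']
      intro τ₂ h2
      rw [mem_closedBall, dist_zero_right] at h2
      have hp : τ₂ • b ∈ closedBall (0 : W) ρ := by simpa using hin 0 τ₂ (by simpa using hr₁0.le) h2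
      have hG : DifferentiableAt ℂ (fun τ : ℂ => fderiv ℂ E (τ • b)) τ₂ :=
        ((hE _ (hball hp)).fderiv.differentiableAt).comp τ₂ (differentiableAt_id.smul_const b)
      exact (hG.clm_apply (differentiableAt_const a)).differentiableWithinAt
    · intro τ₂ h2
      rw [mem_sphere, dist_zero_right] at h2
      exact inner τ₂ h2.le
  calc ‖mixedDeriv E a b‖ ≤ S / r₁ / r₂ := outer
    _ = 4 * S / ρ ^ 2 * ‖a‖ * ‖b‖ := by rw [hr₁, hr₂]; field_simp; ring

/-- **(F) The Cauchy bilinear estimate, radius α₂ itself**: E analytic on ‖𝐀‖ < α ((4.4)) with ∣E∣ ≤ S there ((1.18))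
⇒ ∣∂²/∂τ₁∂τ₂ E(τ₁a + τ₂b)∣₀∣ ≤ 4Sα⁻²‖a‖‖b‖ (the closed-sub-ball bound for every ρ < α, then ρ ↑ α).  This is the
r = n = 2 instance of the arithmetic behind the printed (4.5) constant (2n²B₃α₂⁻¹)ⁿE₀ (with the factors B₃ of p. 282
kept separate, cf. `kernelBound_of_repr435`): 4 ≤ 64. [cite: Balaban1987RG1, (4.5) p.282] -/
theorem norm_mixedDeriv_le {E : W → ℂ} {α S : ℝ} (hα : 0 < α)
    (hE : AnalyticOnNhd ℂ E (ball 0 α)) (hS : ∀ v ∈ ball (0 : W) α, ‖E v‖ ≤ S) (a b : W) :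
    ‖mixedDeriv E a b‖ ≤ 4 * S / α ^ 2 * ‖a‖ * ‖b‖ := by
  have key : ∀ ρ, 0 < ρ → ρ < α → ‖mixedDeriv E a b‖ ≤ 4 * S / ρ ^ 2 * ‖a‖ * ‖b‖ :=
    fun ρ h1 h2 => norm_mixedDeriv_le_of_closedBall hE h1 h2
      (fun v hv => hS v (closedBall_subset_ball h2 hv)) a b
  have hc : ContinuousAt (fun ρ : ℝ => 4 * S / ρ ^ 2 * ‖a‖ * ‖b‖) α := by
    have hne : α ^ 2 ≠ 0 := pow_ne_zero 2 hα.ne'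
    exact ((continuousAt_const.div (continuousAt_id.pow 2) (by simpa using hne)).mul
      continuousAt_const).mul continuousAt_const
  have ht : Tendsto (fun ρ : ℝ => 4 * S / ρ ^ 2 * ‖a‖ * ‖b‖) (𝓝[<] α)
      (𝓝 (4 * S / α ^ 2 * ‖a‖ * ‖b‖)) := hc.tendsto.mono_left nhdsWithin_le_nhds
  refine ge_of_tendsto ht ?_
  have h1 : ∀ᶠ ρ in 𝓝[<] α, ρ ∈ Set.Iio α := eventually_mem_nhdsWithin
  have h2 : ∀ᶠ ρ in 𝓝[<] α, 0 < ρ := (eventually_gt_nhds hα).filter_mono nhdsWithin_le_nhds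
  filter_upwards [h1, h2] with ρ hρα hρ using key ρ hρ hρα

/-- **(F) ⇒ the leaf `hQ` of (B)**: for the family E_X = [𝐀 ↦ 𝐄^{(j)}(X, exp iξ𝐀)], analytic on (4.4) with the
bound (1.18) ∣E_X∣ ≤ E₀e^{−κd_j(X)} there, the real kernel Q_X(a, b) = Re ∂²/∂τ₁∂τ₂ E_X(τ₁a + τ₂b)∣₀ obeys
∣Q_X(a, b)∣ ≤ 4E₀α₂⁻² e^{−κd_j(X)} ‖a‖‖b‖ — the shape `hQ` of `kernelBound_of_repr435` with A = 4E₀α₂⁻².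
[cite: Balaban1987RG1, (1.18) p.263 and (4.3)-(4.5) pp.281-282] -/
theorem qBound_of_analytic (EX : S.Dom → W → ℂ) {α₂ E₀ κ : ℝ} (hα₂ : 0 < α₂)
    (han : ∀ X, AnalyticOnNhd ℂ (EX X) (ball 0 α₂))
    (h118 : ∀ X, ∀ v ∈ ball (0 : W) α₂, ‖EX X v‖ ≤ E₀ * Real.exp (-κ * S.dj X)) (X : S.Dom) (a b : W) :
    |(mixedDeriv (EX X) a b).re| ≤ 4 * E₀ / α₂ ^ 2 * Real.exp (-κ * S.dj X) * ‖a‖ * ‖b‖ :=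
  calc |(mixedDeriv (EX X) a b).re| ≤ ‖mixedDeriv (EX X) a b‖ := Complex.abs_re_le_norm _
    _ ≤ 4 * (E₀ * Real.exp (-κ * S.dj X)) / α₂ ^ 2 * ‖a‖ * ‖b‖ := norm_mixedDeriv_le hα₂ (han X) (h118 X) a b
    _ = 4 * E₀ / α₂ ^ 2 * Real.exp (-κ * S.dj X) * ‖a‖ * ‖b‖ := by ring

/-- **(A)+(B)+(F) on one finite system**: with the Cauchy leaf discharged, ∣Σ_X 𝐄^{(2)}(X, x, y)∣ ≤
4E₀α₂⁻² B₃² e^{δ₁Mc₁} K₀K₁ e^{−δ₁∣x − y∣}, δ₁ = ½ min{δ₀, κM⁻¹}. [cite: Balaban1987RG1, (5.10) p.293] -/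
theorem abs_twoPoint_le_of_analytic (G : SiteGeometry C Λ) {ρ : Λ → Λ → ℝ} (EX : S.Dom → W → ℂ)
    (h : S.Dom → Λ → W) (E2 : S.Dom → Λ → Λ → ℝ) {α₂ E₀ B₃ κ δ₀ M c₁ K₀ K₁ : ℝ} (hα₂ : 0 < α₂) (hE₀ : 0 ≤ E₀)
    (hB₃ : 0 ≤ B₃) (hK₀ : 0 ≤ K₀) (hδ₀ : 0 ≤ δ₀) (hκ : 0 ≤ κ) (hM : 0 < M)
    (han : ∀ X, AnalyticOnNhd ℂ (EX X) (ball 0 α₂))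
    (h118 : ∀ X, ∀ v ∈ ball (0 : W) α₂, ‖EX X v‖ ≤ E₀ * Real.exp (-κ * S.dj X))
    (hrepr : ∀ X x y, E2 X x y = (mixedDeriv (EX X) (h X x) (h X y)).re)
    (hh : ∀ X x, ‖h X x‖ ≤ B₃ * Real.exp (-δ₀ * G.distD x X))
    (hgeo : GeomLeaf G ρ M c₁) (hcube : CubeSumLeaf G (δ₀ / 2) K₁) (htree : TreeLeaf C (κ / 2) K₀) (x y : Λ) :
    |∑ X, E2 X x y| ≤ 4 * E₀ / α₂ ^ 2 * B₃ ^ 2 * Real.exp (delta1 δ₀ κ M * M * c₁) * K₀ * K₁ *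
      Real.exp (-(delta1 δ₀ κ M) * ρ x y) :=
  abs_twoPoint_le_of_repr435 G (V := fun _ => W) (fun X a b => (mixedDeriv (EX X) a b).re) h E2
    (A := 4 * E₀ / α₂ ^ 2) (by positivity) hB₃ hK₀ hδ₀ hκ hM hrepr (qBound_of_analytic EX hα₂ han h118)
    hh hgeo hcube htree x y

/-- **The whole chain with the Cauchy leaf discharged** (census row G-B12s-15, v2): a family of finite systems with,
on each, the terms 𝐀 ↦ 𝐄^{(j)}(X, exp iξ𝐀) analytic on (4.4) and bounded by (1.18) there, the representation
(4.35)/(4.3) of the kernel as the real part of the mixed τ-derivative on the pair of restricted linearized-minimizer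
responses, their decay (p. 282), the geometry, cube-sum and domain-sum leaves with volume-uniform constants, window
isometric embeddings of ℤᵈ and the limit (5.1) ⇒ `B12Sec2to5.Decay510 P (4E₀α₂⁻² B₃² e^{δ₁Mc₁} K₀ K₁) δ₁`,
δ₁ = ½ min{δ₀, κM⁻¹}. [cite: Balaban1987RG1, (5.10) p.293] -/
theorem decay510_of_analytic_leaves {d : ℕ} (Sn : ℕ → LocDomainSys) (Cn : (n : ℕ) → B12.CubeCover (Sn n))
    (Λn : ℕ → Type*) (Gn : (n : ℕ) → SiteGeometry (Cn n) (Λn n)) (ρn : (n : ℕ) → Λn n → Λn n → ℝ)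
    (Wn : ℕ → Type*) [∀ n, NormedAddCommGroup (Wn n)] [∀ n, NormedSpace ℂ (Wn n)]
    (EXn : (n : ℕ) → (Sn n).Dom → Wn n → ℂ) (hn : (n : ℕ) → (Sn n).Dom → Λn n → Wn n)
    (E2n : (n : ℕ) → (Sn n).Dom → Λn n → Λn n → ℝ) (e : (n : ℕ) → (Fin d → ℤ) → Λn n)
    (P : (Fin d → ℤ) → ℝ) {α₂ E₀ B₃ κ δ₀ M c₁ K₀ K₁ : ℝ} (hα₂ : 0 < α₂) (hE₀ : 0 ≤ E₀) (hB₃ : 0 ≤ B₃)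
    (hK₀ : 0 ≤ K₀) (hδ₀ : 0 ≤ δ₀) (hκ : 0 ≤ κ) (hM : 0 < M)
    (han : ∀ n X, AnalyticOnNhd ℂ (EXn n X) (ball 0 α₂))
    (h118 : ∀ n X, ∀ v ∈ ball (0 : Wn n) α₂, ‖EXn n X v‖ ≤ E₀ * Real.exp (-κ * (Sn n).dj X))
    (hrepr : ∀ n X x y, E2n n X x y = (mixedDeriv (EXn n X) (hn n X x) (hn n X y)).re)
    (hh : ∀ n X x, ‖hn n X x‖ ≤ B₃ * Real.exp (-δ₀ * (Gn n).distD x X))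
    (hgeo : ∀ n, GeomLeaf (Gn n) (ρn n) M c₁) (hcube : ∀ n, CubeSumLeaf (Gn n) (δ₀ / 2) K₁)
    (htree : ∀ n, TreeLeaf (Cn n) (κ / 2) K₀)
    (hρ : ∀ z, ∀ᶠ n in atTop, ρn n (e n 0) (e n z) = B12Sec2to5.l1 z)
    (hlim : ∀ z, Tendsto (fun n => ∑ X, E2n n X (e n 0) (e n z)) atTop (𝓝 (P z))) :
    B12Sec2to5.Decay510 P (4 * E₀ / α₂ ^ 2 * B₃ ^ 2 * Real.exp (delta1 δ₀ κ M * M * c₁) * K₀ * K₁)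
      (delta1 δ₀ κ M) :=
  decay510_of_leaves Sn Cn Λn Gn ρn (fun n _ => Wn n) (fun n X a b => (mixedDeriv (EXn n X) a b).re) hn E2n e P
    (A := 4 * E₀ / α₂ ^ 2) (by positivity) hB₃ hK₀ hδ₀ hκ hM hrepr
    (fun n X a b => qBound_of_analytic (EXn n) hα₂ (han n) (h118 n) X a b) hh hgeo hcube htree hρ hlim

end Cauchy


end Literature.MathematicalPhysics.QuantumFieldTheory.Balaban1983to89.B12Decay510
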